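import Mathlib
import HarnessLib

/-!
# Main reduction for stub S1 of crux `DressedCharge` — helper 1: generic lattice operator algebra

Crux stmt-AtomisticToContinuum-13509 (`HiddenChargeMazur.DressedCharge`), line `birth`, stub G
`stub_mainReduction` (lead). Generic operator algebra in the lattice polynomial ring
`MvPolynomial (ℤ ⊕ ℤ) R` (`X (inl x) = q_x`, `X (inr x) = p_x`): the shifts
`rename (Sum.map (· + k) (· + k))`, the momentum reversal `aeval (q ↦ q, p ↦ -p)`, their interplay with
`pderiv` and with `MvPolynomial.mkDerivation R h` for a GENERAL generator assignment `h` (shift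
equivariance, reversal parity, base change along a ring hom), a conjugation principle and a commutation
criterion for derivations, and degree bookkeeping (derivations with homogeneous generator images shift
the degree; uniqueness of the homogeneous decomposition). No definitions, no notation.
-/

noncomputable section

namespace Summit.AtomisticToContinuum.FouriersLaw.Theorems.DressedCharge

open MvPolynomial

variable {R : Type*} [CommRing R]

/-! ## Shifts -/

/-- Composition of shifts. -/
theorem shift_shift (j k : ℤ) (f : MvPolynomial (ℤ ⊕ ℤ) R) :
    rename (Sum.map (fun i : ℤ => i + j) (fun i : ℤ => i + j))
      (rename (Sum.map (fun i : ℤ => i + k) (fun i : ℤ => i + k)) f) =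
    rename (Sum.map (fun i : ℤ => i + (k + j)) (fun i : ℤ => i + (k + j))) f := by
  rw [rename_rename]
  have : (Sum.map (fun i : ℤ => i + j) (fun i : ℤ => i + j)) ∘ (Sum.map (fun i : ℤ => i + k) (fun i : ℤ => i + k))
      = Sum.map (fun i : ℤ => i + (k + j)) (fun i : ℤ => i + (k + j)) := by
    funext v
    rcases v with i | i <;> simp [add_assoc]
  rw [this]

/-- The trivial shift. -/
theorem shift_zero (f : MvPolynomial (ℤ ⊕ ℤ) R) :
    rename (Sum.map (fun i : ℤ => i + 0) (fun i : ℤ => i + 0)) f = f := by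
  have : (Sum.map (fun i : ℤ => i + 0) (fun i : ℤ => i + 0)) = id := by
    funext v; rcases v with i | i <;> simp
  rw [this]
  exact congrArg (fun φ : MvPolynomial (ℤ ⊕ ℤ) R →ₐ[R] MvPolynomial (ℤ ⊕ ℤ) R => φ f) rename_id

/-- Shifting back and forth. -/
theorem shift_neg_shift (k : ℤ) (f : MvPolynomial (ℤ ⊕ ℤ) R) :
    rename (Sum.map (fun i : ℤ => i + -k) (fun i : ℤ => i + -k))
      (rename (Sum.map (fun i : ℤ => i + k) (fun i : ℤ => i + k)) f) = f := by
  rw [shift_shift, add_neg_cancel, shift_zero]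

/-- Shifting forth and back. -/
theorem shift_shift_neg (k : ℤ) (f : MvPolynomial (ℤ ⊕ ℤ) R) :
    rename (Sum.map (fun i : ℤ => i + k) (fun i : ℤ => i + k))
      (rename (Sum.map (fun i : ℤ => i + -k) (fun i : ℤ => i + -k)) f) = f := by
  rw [shift_shift, neg_add_cancel, shift_zero]

/-- The shift map on indices is injective. -/
theorem shiftIndex_injective (k : ℤ) :
    Function.Injective (Sum.map (fun i : ℤ => i + k) (fun i : ℤ => i + k)) :=
  Sum.map_injective.mpr ⟨fun a b h => by simpa using h, fun a b h => by simpa using h⟩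

/-- A shift is injective on polynomials. -/
theorem shift_injective (k : ℤ) :
    Function.Injective (rename (Sum.map (fun i : ℤ => i + k) (fun i : ℤ => i + k)) :
      MvPolynomial (ℤ ⊕ ℤ) R → MvPolynomial (ℤ ⊕ ℤ) R) :=
  rename_injective _ (shiftIndex_injective k)

/-- Shift of a position variable. -/
@[simp] theorem shift_X_inl (k x : ℤ) :
    rename (Sum.map (fun i : ℤ => i + k) (fun i : ℤ => i + k)) (X (Sum.inl x) : MvPolynomial (ℤ ⊕ ℤ) R) =
      X (Sum.inl (x + k)) := by
  simp [rename_X]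

/-- Shift of a momentum variable. -/
@[simp] theorem shift_X_inr (k x : ℤ) :
    rename (Sum.map (fun i : ℤ => i + k) (fun i : ℤ => i + k)) (X (Sum.inr x) : MvPolynomial (ℤ ⊕ ℤ) R) =
      X (Sum.inr (x + k)) := by
  simp [rename_X]

/-- `pderiv` after a shift. -/
theorem pderiv_shift (k : ℤ) (v : ℤ ⊕ ℤ) (f : MvPolynomial (ℤ ⊕ ℤ) R) :
    pderiv (Sum.map (fun i : ℤ => i + k) (fun i : ℤ => i + k) v)
      (rename (Sum.map (fun i : ℤ => i + k) (fun i : ℤ => i + k)) f) =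
    rename (Sum.map (fun i : ℤ => i + k) (fun i : ℤ => i + k)) (pderiv v f) :=
  pderiv_rename (shiftIndex_injective k) v f

/-- `pderiv` at a position after a shift. -/
theorem pderiv_inl_shift (k x : ℤ) (f : MvPolynomial (ℤ ⊕ ℤ) R) :
    pderiv (Sum.inl (x + k)) (rename (Sum.map (fun i : ℤ => i + k) (fun i : ℤ => i + k)) f) =
      rename (Sum.map (fun i : ℤ => i + k) (fun i : ℤ => i + k)) (pderiv (Sum.inl x) f) := by
  simpa using pderiv_shift k (Sum.inl x) f

/-- `pderiv` at a momentum after a shift. -/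
theorem pderiv_inr_shift (k x : ℤ) (f : MvPolynomial (ℤ ⊕ ℤ) R) :
    pderiv (Sum.inr (x + k)) (rename (Sum.map (fun i : ℤ => i + k) (fun i : ℤ => i + k)) f) =
      rename (Sum.map (fun i : ℤ => i + k) (fun i : ℤ => i + k)) (pderiv (Sum.inr x) f) := by
  simpa using pderiv_shift k (Sum.inr x) f

/-! ## Momentum reversal `Θ = aeval (q ↦ q, p ↦ -p)` -/

/-- `Θ` on a position variable. -/
@[simp] theorem theta_X_inl (x : ℤ) :
    MvPolynomial.aeval (R := R) (Sum.elim (fun i : ℤ => (X (Sum.inl i) : MvPolynomial (ℤ ⊕ ℤ) R))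
      (fun i : ℤ => -X (Sum.inr i))) (X (Sum.inl x)) = X (Sum.inl x) := by
  simp

/-- `Θ` on a momentum variable. -/
@[simp] theorem theta_X_inr (x : ℤ) :
    MvPolynomial.aeval (R := R) (Sum.elim (fun i : ℤ => (X (Sum.inl i) : MvPolynomial (ℤ ⊕ ℤ) R))
      (fun i : ℤ => -X (Sum.inr i))) (X (Sum.inr x)) = -X (Sum.inr x) := by
  simp

/-- `Θ` on a constant. -/
@[simp] theorem theta_C (r : R) :
    MvPolynomial.aeval (R := R) (Sum.elim (fun i : ℤ => (X (Sum.inl i) : MvPolynomial (ℤ ⊕ ℤ) R))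
      (fun i : ℤ => -X (Sum.inr i))) (C r) = C r :=
  MvPolynomial.aeval_C _ r

/-- `Θ` is an involution. -/
theorem theta_theta (f : MvPolynomial (ℤ ⊕ ℤ) R) :
    MvPolynomial.aeval (R := R) (Sum.elim (fun i : ℤ => (X (Sum.inl i) : MvPolynomial (ℤ ⊕ ℤ) R))
      (fun i : ℤ => -X (Sum.inr i)))
      (MvPolynomial.aeval (R := R) (Sum.elim (fun i : ℤ => (X (Sum.inl i) : MvPolynomial (ℤ ⊕ ℤ) R))
        (fun i : ℤ => -X (Sum.inr i))) f) = f := by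
  induction f using MvPolynomial.induction_on with
  | C a => simp
  | add p q hp hq => simp only [map_add, hp, hq]
  | mul_X p v hp =>
    rw [map_mul, map_mul, hp]
    rcases v with y | y <;> simp

/-- `Θ` commutes with shifts. -/
theorem theta_shift (k : ℤ) (f : MvPolynomial (ℤ ⊕ ℤ) R) :
    MvPolynomial.aeval (R := R) (Sum.elim (fun i : ℤ => (X (Sum.inl i) : MvPolynomial (ℤ ⊕ ℤ) R))
      (fun i : ℤ => -X (Sum.inr i))) (rename (Sum.map (fun i : ℤ => i + k) (fun i : ℤ => i + k)) f) =
    rename (Sum.map (fun i : ℤ => i + k) (fun i : ℤ => i + k))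
      (MvPolynomial.aeval (R := R) (Sum.elim (fun i : ℤ => (X (Sum.inl i) : MvPolynomial (ℤ ⊕ ℤ) R))
        (fun i : ℤ => -X (Sum.inr i))) f) := by
  induction f using MvPolynomial.induction_on with
  | C a => simp
  | add p q hp hq => simp only [map_add, hp, hq]
  | mul_X p v hp =>
    simp only [map_mul, hp]
    rcases v with y | y <;> simp [rename_X]

/-- `pderiv` at a position commutes with `Θ`. -/
theorem pderiv_inl_theta (x : ℤ) (f : MvPolynomial (ℤ ⊕ ℤ) R) :
    pderiv (Sum.inl x) (MvPolynomial.aeval (R := R)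
      (Sum.elim (fun i : ℤ => (X (Sum.inl i) : MvPolynomial (ℤ ⊕ ℤ) R)) (fun i : ℤ => -X (Sum.inr i))) f) =
    MvPolynomial.aeval (R := R)
      (Sum.elim (fun i : ℤ => (X (Sum.inl i) : MvPolynomial (ℤ ⊕ ℤ) R)) (fun i : ℤ => -X (Sum.inr i)))
      (pderiv (Sum.inl x) f) := by
  induction f using MvPolynomial.induction_on with
  | C a => simp
  | add p q hp hq => simp only [map_add, hp, hq]
  | mul_X p v hp =>
    rcases v with y | y
    · simp only [map_mul, theta_X_inl, Derivation.leibniz, smul_eq_mul, hp, pderiv_X]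
      by_cases h : Sum.inl y = (Sum.inl x : ℤ ⊕ ℤ)
      · simp [h]
      · simp [h]
    · simp only [map_mul, theta_X_inr, map_neg, Derivation.leibniz, smul_eq_mul, hp, pderiv_X]
      simp

/-- `pderiv` at a momentum anticommutes with `Θ`. -/
theorem pderiv_inr_theta (x : ℤ) (f : MvPolynomial (ℤ ⊕ ℤ) R) :
    pderiv (Sum.inr x) (MvPolynomial.aeval (R := R)
      (Sum.elim (fun i : ℤ => (X (Sum.inl i) : MvPolynomial (ℤ ⊕ ℤ) R)) (fun i : ℤ => -X (Sum.inr i))) f) =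
    -MvPolynomial.aeval (R := R)
      (Sum.elim (fun i : ℤ => (X (Sum.inl i) : MvPolynomial (ℤ ⊕ ℤ) R)) (fun i : ℤ => -X (Sum.inr i)))
      (pderiv (Sum.inr x) f) := by
  induction f using MvPolynomial.induction_on with
  | C a => simp
  | add p q hp hq => simp only [map_add, hp, hq, neg_add]
  | mul_X p v hp =>
    rcases v with y | y
    · simp only [map_mul, theta_X_inl, Derivation.leibniz, smul_eq_mul, hp, pderiv_X]
      simp
    · simp only [map_mul, theta_X_inr, map_neg, Derivation.leibniz, smul_eq_mul, hp, pderiv_X]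
      by_cases h : Sum.inr y = (Sum.inr x : ℤ ⊕ ℤ)
      · simp [h]; ring
      · simp [h]

/-! ## Derivations: conjugation, commutation, base change, shift equivariance, reversal parity -/

/-- If `e` is an algebra automorphism and `D, D'` derivations with `e ∘ D ∘ e⁻¹ = D'` on generators,
then `e ∘ D ∘ e⁻¹ = D'`. -/
theorem conj_derivation_eq {σ : Type*} (e : MvPolynomial σ R ≃ₐ[R] MvPolynomial σ R)
    (D D' : Derivation R (MvPolynomial σ R) (MvPolynomial σ R))
    (h : ∀ v, e (D (e.symm (X v))) = D' (X v)) (f : MvPolynomial σ R) :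
    e (D (e.symm f)) = D' f := by
  let Dc : Derivation R (MvPolynomial σ R) (MvPolynomial σ R) :=
    Derivation.mk' (e.toLinearMap ∘ₗ D.toLinearMap ∘ₗ e.symm.toLinearMap) (by
      intro a b
      show e (D (e.symm (a * b))) = a • e (D (e.symm b)) + b • e (D (e.symm a))
      rw [map_mul, Derivation.leibniz]
      simp only [smul_eq_mul, map_add, map_mul, AlgEquiv.apply_symm_apply])
  have hDc : ∀ g, Dc g = e (D (e.symm g)) := fun g => rfl
  have : Dc = D' := MvPolynomial.derivation_ext fun v => by rw [hDc]; exact h v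
  rw [← hDc, this]

/-- Two derivations whose values on generators are killed by each other commute; in particular
derivations with CONSTANT coefficients commute. -/
theorem derivation_comm_of_const {σ : Type*}
    (D D' : Derivation R (MvPolynomial σ R) (MvPolynomial σ R))
    (h : ∀ v, D (D' (X v)) = 0) (h' : ∀ v, D' (D (X v)) = 0) (f : MvPolynomial σ R) :
    D (D' f) = D' (D f) := by
  have : ⁅D, D'⁆ = 0 := MvPolynomial.derivation_ext fun v => by
    rw [Derivation.commutator_apply, h, h', sub_zero, Derivation.zero_apply]
  have hf := congrArg (fun δ : Derivation R (MvPolynomial σ R) (MvPolynomial σ R) => δ f) this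
  simp only [Derivation.commutator_apply, Derivation.zero_apply, sub_eq_zero] at hf
  exact hf

/-- `mkDerivation` is additive in the generator assignment. -/
theorem mkDerivation_add_apply {σ : Type*} (h h' : σ → MvPolynomial σ R) (f : MvPolynomial σ R) :
    MvPolynomial.mkDerivation R (h + h') f = MvPolynomial.mkDerivation R h f + MvPolynomial.mkDerivation R h' f := by
  rw [← Derivation.add_apply]
  congr 1
  exact MvPolynomial.derivation_ext fun v => by simp [mkDerivation_X]

/-- `MvPolynomial.map` intertwines two `mkDerivation`s whose generator images correspond. -/
theorem map_mkDerivation {S : Type*} [CommRing S] {σ : Type*} (φ : R →+* S)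
    (h : σ → MvPolynomial σ R) (h' : σ → MvPolynomial σ S) (hh : ∀ v, MvPolynomial.map φ (h v) = h' v)
    (f : MvPolynomial σ R) :
    MvPolynomial.map φ (MvPolynomial.mkDerivation R h f) = MvPolynomial.mkDerivation S h' (MvPolynomial.map φ f) := by
  induction f using MvPolynomial.induction_on with
  | C a => simp
  | add p q hp hq => simp only [map_add, hp, hq]
  | mul_X p v hp =>
    simp only [map_mul, map_X, Derivation.leibniz, mkDerivation_X, smul_eq_mul, map_add, hp, hh]

/-- A `mkDerivation` with a rename-EQUIVARIANT generator assignment commutes with that rename. -/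
theorem mkDerivation_rename_of_equivariant {σ : Type*} (s : σ → σ) (h : σ → MvPolynomial σ R)
    (hs : ∀ v, rename s (h v) = h (s v)) (f : MvPolynomial σ R) :
    MvPolynomial.mkDerivation R h (rename s f) = rename s (MvPolynomial.mkDerivation R h f) := by
  induction f using MvPolynomial.induction_on with
  | C r => simp
  | add p q hp hq => simp only [map_add, hp, hq]
  | mul_X p v hp =>
    rw [map_mul, rename_X, Derivation.leibniz, Derivation.leibniz, map_add, hp]
    simp only [smul_eq_mul, map_mul, mkDerivation_X, rename_X, hs]

/-- A `mkDerivation` on the lattice ring whose generator assignment is odd on positions and even on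
momenta under `Θ` (as the Liouville derivation: `q ↦ p` odd, `p ↦ F(q)` even) ANTIcommutes with `Θ`. -/
theorem mkDerivation_theta_of_parity (h : ℤ ⊕ ℤ → MvPolynomial (ℤ ⊕ ℤ) R)
    (hq : ∀ i, MvPolynomial.aeval (R := R) (Sum.elim (fun i : ℤ => (X (Sum.inl i) : MvPolynomial (ℤ ⊕ ℤ) R))
      (fun i : ℤ => -X (Sum.inr i))) (h (Sum.inl i)) = -h (Sum.inl i))
    (hp : ∀ i, MvPolynomial.aeval (R := R) (Sum.elim (fun i : ℤ => (X (Sum.inl i) : MvPolynomial (ℤ ⊕ ℤ) R))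
      (fun i : ℤ => -X (Sum.inr i))) (h (Sum.inr i)) = h (Sum.inr i))
    (f : MvPolynomial (ℤ ⊕ ℤ) R) :
    MvPolynomial.mkDerivation R h (MvPolynomial.aeval (R := R)
      (Sum.elim (fun i : ℤ => (X (Sum.inl i) : MvPolynomial (ℤ ⊕ ℤ) R)) (fun i : ℤ => -X (Sum.inr i))) f) =
    -MvPolynomial.aeval (R := R)
      (Sum.elim (fun i : ℤ => (X (Sum.inl i) : MvPolynomial (ℤ ⊕ ℤ) R)) (fun i : ℤ => -X (Sum.inr i)))
      (MvPolynomial.mkDerivation R h f) := by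
  induction f using MvPolynomial.induction_on with
  | C r => simp
  | add p q hp' hq' => rw [map_add, map_add, hp', hq', map_add, map_add, neg_add]
  | mul_X p v hp' =>
    rcases v with x | x
    · simp only [map_mul, theta_X_inl, Derivation.leibniz, smul_eq_mul, mkDerivation_X, map_add, hp', hq]
      ring
    · simp only [map_mul, theta_X_inr, map_neg, Derivation.leibniz, smul_eq_mul,
        mkDerivation_X, map_add, hp', hp]
      ring

/-- Base change commutes with momentum reversal. -/
theorem map_theta {S : Type*} [CommRing S] (φ : R →+* S) (f : MvPolynomial (ℤ ⊕ ℤ) R) :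
    MvPolynomial.map φ (MvPolynomial.aeval (R := R)
      (Sum.elim (fun i : ℤ => (X (Sum.inl i) : MvPolynomial (ℤ ⊕ ℤ) R)) (fun i : ℤ => -X (Sum.inr i))) f) =
    MvPolynomial.aeval (R := S) (Sum.elim (fun i : ℤ => (X (Sum.inl i) : MvPolynomial (ℤ ⊕ ℤ) S))
      (fun i : ℤ => -X (Sum.inr i))) (MvPolynomial.map φ f) := by
  induction f using MvPolynomial.induction_on with
  | C r => simp
  | add p q hp hq => simp only [map_add, hp, hq]
  | mul_X p v hp =>
    simp only [map_mul, hp, map_X]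
    rcases v with x | x <;> simp [map_X]

/-! ## Degree bookkeeping -/

/-- A `mkDerivation` whose generator images are homogeneous of degree `e` maps homogeneous polynomials
of degree `n + 1` to homogeneous polynomials of degree `n + e`. -/
theorem isHomogeneous_mkDerivation {σ : Type*} (h : σ → MvPolynomial σ R) (e : ℕ)
    (hh : ∀ v, (h v).IsHomogeneous e) {f : MvPolynomial σ R} {n : ℕ} (hf : f.IsHomogeneous (n + 1)) :
    (MvPolynomial.mkDerivation R h f).IsHomogeneous (n + e) := by
  classical
  rw [f.as_sum, map_sum]
  refine IsHomogeneous.sum _ _ _ fun d hd => ?_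
  rw [mkDerivation_monomial]
  have hdeg : d.degree = n + 1 := by
    rw [Finsupp.degree_eq_weight_one]
    exact hf (mem_support_iff.mp hd)
  rw [Finsupp.sum, Finset.smul_sum]
  refine IsHomogeneous.sum _ _ _ fun i hi => ?_
  rw [smul_eq_mul, smul_eq_C_mul, ← mul_assoc]
  have h1 : ((C (coeff d f) : MvPolynomial σ R) * monomial (d - Finsupp.single i 1) ((d i : ℕ) : R)).IsHomogeneous n := by
    rw [C_mul_monomial]
    apply isHomogeneous_monomial
    have hle : Finsupp.single i 1 ≤ d := by
      rw [Finsupp.single_le_iff]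
      exact Nat.one_le_iff_ne_zero.mpr (Finsupp.mem_support_iff.mp hi)
    have := congrArg Finsupp.degree (tsub_add_cancel_of_le hle)
    rw [map_add, hdeg, Finsupp.degree_single] at this
    omega
  simpa using h1.mul (hh i)

/-- A derivation kills homogeneous polynomials of degree `0` (constants). -/
theorem derivation_eq_zero_of_isHomogeneous_zero {σ : Type*}
    (D : Derivation R (MvPolynomial σ R) (MvPolynomial σ R)) {f : MvPolynomial σ R}
    (hf : f.IsHomogeneous 0) : D f = 0 := by
  have : f = C (coeff 0 f) := by
    rw [← totalDegree_eq_zero_iff_eq_C]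
    exact Nat.le_zero.mp hf.totalDegree_le
  rw [this, derivation_C]

/-- If `Σ_{n ∈ s} x n = 0` with `x n` homogeneous of degree `n`, then each `x n = 0`. -/
theorem eq_zero_of_sum_isHomogeneous_eq_zero {σ : Type*} (s : Finset ℕ) (x : ℕ → MvPolynomial σ R)
    (hx : ∀ n ∈ s, (x n).IsHomogeneous n) (hsum : ∑ n ∈ s, x n = 0) : ∀ n ∈ s, x n = 0 := by
  classical
  intro n hn
  have key : homogeneousComponent n (∑ m ∈ s, x m) = x n := by
    rw [map_sum]
    rw [Finset.sum_eq_single n]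
    · exact homogeneousComponent_eq_self (hx n hn)
    · intro m hm hmn
      rw [homogeneousComponent_of_mem (hx m hm), if_neg (Ne.symm hmn)]
    · intro h; exact absurd hn h
  rw [hsum, map_zero] at key
  exact key.symm

/-- Shifts preserve homogeneity. -/
theorem isHomogeneous_shift (k : ℤ) {f : MvPolynomial (ℤ ⊕ ℤ) R} {n : ℕ} (hf : f.IsHomogeneous n) :
    (rename (Sum.map (fun i : ℤ => i + k) (fun i : ℤ => i + k)) f).IsHomogeneous n :=
  hf.rename_isHomogeneous

/-- Momentum reversal preserves homogeneity. -/
theorem isHomogeneous_theta {f : MvPolynomial (ℤ ⊕ ℤ) R} {n : ℕ} (hf : f.IsHomogeneous n) :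
    (MvPolynomial.aeval (R := R) (Sum.elim (fun i : ℤ => (X (Sum.inl i) : MvPolynomial (ℤ ⊕ ℤ) R))
      (fun i : ℤ => -X (Sum.inr i))) f).IsHomogeneous n := by
  have := hf.aeval (Sum.elim (fun i : ℤ => (X (Sum.inl i) : MvPolynomial (ℤ ⊕ ℤ) R)) (fun i : ℤ => -X (Sum.inr i)))
    (n := 1) (fun v => by
      rcases v with i | i
      · exact isHomogeneous_X R _
      · exact (isHomogeneous_X R _).neg)
  simpa using this

/-- ANCHOR of this helper file (registered sub-goal of the crux): momentum reversal is an involution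
on real lattice polynomials. -/
theorem mainReduction_theta_involutive_real :
    ∀ f : MvPolynomial (ℤ ⊕ ℤ) ℝ, MvPolynomial.aeval (Sum.elim (fun i : ℤ => (MvPolynomial.X (Sum.inl i) : MvPolynomial (ℤ ⊕ ℤ) ℝ)) (fun i : ℤ => -MvPolynomial.X (Sum.inr i))) (MvPolynomial.aeval (Sum.elim (fun i : ℤ => (MvPolynomial.X (Sum.inl i) : MvPolynomial (ℤ ⊕ ℤ) ℝ)) (fun i : ℤ => -MvPolynomial.X (Sum.inr i))) f) = f :=
  fun f => theta_theta f

end Summit.AtomisticToContinuum.FouriersLaw.Theorems.DressedCharge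

end
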